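import Summits.HodgeConjecture.HodgeConjecture.Theorems.R90S4StableTransportDict      -- ★ p863911 (this seat, (B2-S) part 1): `IsStableTransportDict`, `isStablyConjGAt_of_isConj`, `cartanWeight`
import Summits.HodgeConjecture.HodgeConjecture.Theorems.R90S4StableClassSplitCartan     -- ★ p863493 (this seat, (S2-M) part 2): `isStablyConjGAt_iff_isConj_of_mem_cmTorus` (on `M^{reg}` stable class = class)
import HarnessLib

/-!
# R90-TF · S4 «Ch. 13.1–2», brick (B2-S) support — THE STABLE-TRANSPORT DICTIONARY ASSEMBLED FROM PER-MEMBER PACKAGES, AND THE CHEAP CARTAN TYPES (0), (3)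
# (Rogawski 1990, §3.6 pp. 28–31: `𝔇(T∕F) = 1` for the Cartans `T ≃ E^× × E¹` (type (0)) and `T ≃ K¹_{K∕E}`, `K∕F` a cubic-type extension (type (3)) — «stable conjugacy
# and conjugacy coincide»; §12.5 p. 182)

Cell `hodgecm-mathlib`, crux H413 (`stmt-HodgeConjecture-24833`, lane `--supports … --as helper`), route of record `HCCMUnconditional` (no route verbs;
count-neutral).  Programme R90-TF, section S4, dealer K2E2-plan (g7): DEALT BY NAME 2026-09-05T01:06:54Z «the CHEAP-TYPE INSTANTIATION
`Theorems/R90S4StableTransportDictTrivialTypes.lean` — at a member `T ∈ C` of type (0) (`T = M`, ★ p863493) or type (3) (cubic): `m = 1, τ T 0 = T, e = ContinuousMulEquiv.refl`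
discharges (S)(W)(B)(C); EXPORT the assembly pattern «dict from per-member data» so (DICT)(1)(2) only supply their `(m_T, τ_T, e_T)` + four clause proofs»; seat K2E3-p12 (g10).
Consumers: the (DICT) payers per Cartan type ((1) `(E¹)³` R90-C131-p01, (2) `K¹ × E¹` K2E3-p27 ∕ R90-C131-p04, (3) cubic K2E3-p27) assembling ★ `IsStableTransportDict L v C n`
(★ p863911), the hypothesis of ★ p863960 `isStableWeylMeasure_stableCartanMeasure_of_dict` (S-WIF on the term of record `stableCartanMeasure L v C tT n`).

## CONTENTS (`G_v = Gqs L v = U(Φ₃)(L⁺_v)`)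
* §1 **`isStableTransportDict_of_forall_member`** — ASSEMBLY: a dictionary for `(C, n)` from, for every member `T_i`, a PACKAGE `∃ k τ e, k = μ i ∧ (fibre counts = N i) ∧ (S_i) ∧ (W_i)
  ∧ (B_i)` carrying its own length `k` (pinned to a VISIBLE count `μ i`, so no dependent rewriting of `Fin (m i)` is ever needed) and its VISIBLE fibre counts `N i k′ = #{j : τ j = T_{k′}}`,
  plus the two global clauses on visible data: (N) `n = μ i` on `T_i^{reg}` and (C) the Weyl count `Σ_i N i k′ · ([N(T_i):T_i] · μ i)⁻¹ = [N(T_{k′}):T_{k′}]⁻¹`.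
* §2 **`exists_memberPackage_of_stable_eq_class`** — THE CHEAP PACKAGE: at a member `T_i` on whose regular points STABLE CLASS = CLASS (`∀ t ∈ T_i^{reg}, ∀ γ′, t ∼_{st} γ′ → t ∼ γ′`),
  the data `k = 1`, `τ 0 = i`, `e 0 = ContinuousMulEquiv.refl` satisfy (S)(W)(B) with fibre counts `N i k′ = if k′ = i then 1 else 0`; `mk_mem_stableIndexSet` (`⟦t⟧` is in the index set).
* §3 type (0): **`isConj_of_isStablyConjGAt_of_eq_cmTorus`** — the member `T = M` has stable class = class on `M^{reg}` (★ p863493 `isStablyConjGAt_iff_isConj_of_mem_cmTorus`, `v` non-split);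
  hence `exists_memberPackage_of_eq_cmTorus`.  Type (3) (cubic): the same hypothesis is K2E3-p27's ★-pending `isStablyConjGAt_iff_isConj_of_isField_cartanAlgebra` — it feeds §2 verbatim.
* §4 **`isStableTransportDict_one_of_forall_stable_eq_class`** — if EVERY member of `C` has stable class = class on its regular points, `IsStableTransportDict L v C (fun _ => 1)` outright
  ((C) collapses to `Σ_i [k′ = i] · [N(T_i):T_i]⁻¹ = [N(T_{k′}):T_{k′}]⁻¹`).

HONEST LABEL: HC_CM is proved only modulo the 7 printed citations (2 remaining named inputs: hLiu418 = stmt-HodgeConjecture-24832, h413 = stmt-HodgeConjecture-24833) until rung 0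
closes.  Assembly pattern + the two cheap types; the dictionary for the actual Cartan system of `U(Φ₃)(L⁺_v)` still needs types (1) and (2) ((DICT)(1)(2) OPEN), and (W-NP) stays OPEN
behind them, T-WIF and (NORM-RAT).  REL ≠ ★ ≠ BUILT.  Theorems only; no instance, no notation, no `sorry`.

## References
* [Rogawski1990] J. D. Rogawski, *Automorphic Representations of Unitary Groups in Three Variables*, Ann. of Math. Stud. 123 (1990), §3.6 pp. 28–31; §12.5 p. 182.
-/

set_option autoImplicit false
set_option linter.dupNamespace false

noncomputable section

open MeasureTheory Measure Set Filter Topology Function NumberField IsDedekindDomain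
open Literature.MeasureTheory.Group
open Literature.NumberTheory.Automorphic Literature.NumberTheory.Automorphic.UnitaryGroup Literature.NumberTheory.Rogawski1990
open Summit.HodgeConjecture.HodgeConjecture.Cruxes.H413
open scoped ENNReal NNReal MatrixGroups Pointwise

namespace Summit.HodgeConjecture.HodgeConjecture.R90.S4

section TrivialTypes

variable (L : Type) [Field L] [NumberField L] [IsCMField L] (v : HeightOneSpectrum (𝓞 ↥(maximalRealSubfield L)))

/-! ## §1 Assembly of the dictionary from per-member packages -/

/-- **ASSEMBLY: `IsStableTransportDict L v C n` FROM PER-MEMBER PACKAGES.**  Give, for every member `T_i` of `C`, a visible count `μ i` and visible fibre counts `N i : ↥C → ℕ`, and a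
PACKAGE: a length `k` with `k = μ i`, targets `τ : Fin k → C`, transports `e j : T_i ≃ₜ* T_{τ j}` with `#{j : τ j = T_{k′}} = N i k′`, and the three local clauses (S) `e j t ∼_{st} t`,
(W) `D_{T_{τ j}}(e j t) = D_{T_i}(t)` on `T_i^{reg}`, (B) `j ↦ ⟦e j t⟧` a bijection onto `{c | t ∼_{st} out c}` for regular `t`; and the two global clauses on the visible data, (N) `n = μ i` on
`T_i^{reg}` and (C) `Σ_i N i k′ · ([N(T_i):T_i] · μ i)⁻¹ = [N(T_{k′}):T_{k′}]⁻¹`.  Then `(C, n)` carries a stable-transport dictionary (the packages are chosen and glued; (C) is rewritten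
through `k = μ i` and the fibre counts). [cite: Rogawski1990, §3.6 pp. 28–31; §12.5 p. 182] -/
theorem isStableTransportDict_of_forall_member {C : Finset (Subgroup (Gqs L v))} {n : Gqs L v → ℕ} (μ : ↥C → ℕ) (N : ↥C → ↥C → ℕ)
    (hmem : ∀ i : ↥C, ∃ (k : ℕ) (τ : Fin k → ↥C) (e : ∀ j : Fin k, ↥(i : Subgroup (Gqs L v)) ≃ₜ* ↥((τ j : ↥C) : Subgroup (Gqs L v))),
      k = μ i ∧ (∀ k' : ↥C, Nat.card {j : Fin k // τ j = k'} = N i k') ∧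
      (∀ (j : Fin k) (t : ↥(i : Subgroup (Gqs L v))),
          IsStablyConjGAt L (R90.S4.splitFormGL L) v (t : Gqs L v) ((e j t : ↥((τ j : ↥C) : Subgroup (Gqs L v))) : Gqs L v)) ∧
      (∀ (j : Fin k) (t : ↥(i : Subgroup (Gqs L v))), IsRegularElt (((t : Gqs L v)).val : GL (Fin 3) (LocalRing L v)) →
          cartanWeight L v ((τ j : ↥C) : Subgroup (Gqs L v)) (e j t) = cartanWeight L v (i : Subgroup (Gqs L v)) t) ∧
      (∀ t : ↥(i : Subgroup (Gqs L v)), IsRegularElt (((t : Gqs L v)).val : GL (Fin 3) (LocalRing L v)) →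
          Set.BijOn (fun j : Fin k => ConjClasses.mk ((e j t : ↥((τ j : ↥C) : Subgroup (Gqs L v))) : Gqs L v)) Set.univ
            {c : ConjClasses (Gqs L v) | IsStablyConjGAt L (R90.S4.splitFormGL L) v (t : Gqs L v) (Quotient.out c)}))
    (hN : ∀ (i : ↥C) (t : ↥(i : Subgroup (Gqs L v))), IsRegularElt (((t : Gqs L v)).val : GL (Fin 3) (LocalRing L v)) → n (t : Gqs L v) = μ i)
    (hC : ∀ k' : ↥C, ∑ i : ↥C, (N i k' : ℝ) *
        (((((i : Subgroup (Gqs L v)).subgroupOf (Subgroup.normalizer ((i : Subgroup (Gqs L v)) : Set (Gqs L v)))).index : ℝ))⁻¹ * ((μ i : ℝ))⁻¹) =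
      ((((k' : Subgroup (Gqs L v)).subgroupOf (Subgroup.normalizer ((k' : Subgroup (Gqs L v)) : Set (Gqs L v)))).index : ℝ))⁻¹) :
    IsStableTransportDict L v C n := by
  choose k τ e hk hcard hS hW hB using hmem
  refine ⟨k, τ, e, hS, hW, hB, fun i t ht => by rw [hN i t ht, hk i], fun k' => ?_⟩
  simp_rw [hcard, hk]
  exact hC k'

/-! ## §2 The cheap package: a member on whose regular points stable class = class -/

variable {L v} in
/-- `⟦t⟧` belongs to the index set `{c | t ∼_{st} out c}` of ★ `stableOrbitalIntegralRel` at `t` (its representative is conjugate, hence stably conjugate, to `t`).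
[cite: Rogawski1990, §3.6 pp. 28–31] -/
theorem mk_mem_stableIndexSet (t : Gqs L v) :
    ConjClasses.mk t ∈ {c : ConjClasses (Gqs L v) | IsStablyConjGAt L (R90.S4.splitFormGL L) v t (Quotient.out c)} := by
  have h1 : ConjClasses.mk (Quotient.out (ConjClasses.mk t)) = ConjClasses.mk t := by
    rw [← ConjClasses.quotient_mk_eq_mk, Quotient.out_eq]
  exact isStablyConjGAt_of_isConj (ConjClasses.mk_eq_mk_iff_isConj.mp h1.symm)

open scoped Classical in
/-- **THE CHEAP PACKAGE.**  Let `T_i ∈ C` be a member on whose regular points STABLE CLASS = CLASS (`t ∈ T_i^{reg}`, `t ∼_{st} γ′ ⇒ t ∼ γ′` — types (0) and (3) of §3.6, where `𝔇(T∕F) = 1`).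
Then the one-transport data `k = 1`, `τ 0 = i`, `e 0 = ContinuousMulEquiv.refl T_i` are a package for §1: (S) `t ∼_{st} t`; (W) trivially; (B) `0 ↦ ⟦t⟧` is a bijection from `Fin 1` onto
`{c | t ∼_{st} out c} = {⟦t⟧}`; fibre counts `#{j : τ j = T_{k′}} = [k′ = i]`. [cite: Rogawski1990, §3.6 pp. 28–31; §12.5 p. 182] -/
theorem exists_memberPackage_of_stable_eq_class {C : Finset (Subgroup (Gqs L v))} (i : ↥C)
    (hT : ∀ t : ↥(i : Subgroup (Gqs L v)), IsRegularElt (((t : Gqs L v)).val : GL (Fin 3) (LocalRing L v)) →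
      ∀ γ' : Gqs L v, IsStablyConjGAt L (R90.S4.splitFormGL L) v (t : Gqs L v) γ' → IsConj (t : Gqs L v) γ') :
    ∃ (k : ℕ) (τ : Fin k → ↥C) (e : ∀ j : Fin k, ↥(i : Subgroup (Gqs L v)) ≃ₜ* ↥((τ j : ↥C) : Subgroup (Gqs L v))),
      k = 1 ∧ (∀ k' : ↥C, Nat.card {j : Fin k // τ j = k'} = if k' = i then 1 else 0) ∧
      (∀ (j : Fin k) (t : ↥(i : Subgroup (Gqs L v))),
          IsStablyConjGAt L (R90.S4.splitFormGL L) v (t : Gqs L v) ((e j t : ↥((τ j : ↥C) : Subgroup (Gqs L v))) : Gqs L v)) ∧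
      (∀ (j : Fin k) (t : ↥(i : Subgroup (Gqs L v))), IsRegularElt (((t : Gqs L v)).val : GL (Fin 3) (LocalRing L v)) →
          cartanWeight L v ((τ j : ↥C) : Subgroup (Gqs L v)) (e j t) = cartanWeight L v (i : Subgroup (Gqs L v)) t) ∧
      (∀ t : ↥(i : Subgroup (Gqs L v)), IsRegularElt (((t : Gqs L v)).val : GL (Fin 3) (LocalRing L v)) →
          Set.BijOn (fun j : Fin k => ConjClasses.mk ((e j t : ↥((τ j : ↥C) : Subgroup (Gqs L v))) : Gqs L v)) Set.univ
            {c : ConjClasses (Gqs L v) | IsStablyConjGAt L (R90.S4.splitFormGL L) v (t : Gqs L v) (Quotient.out c)}) := by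
  classical
  refine ⟨1, fun _ => i, fun _ => ContinuousMulEquiv.refl _, rfl, fun k' => ?_, fun _ t => isStablyConjGAt_of_isConj (IsConj.refl _), fun _ t _ => rfl,
    fun t ht => ⟨fun _ _ => mk_mem_stableIndexSet (t : Gqs L v), fun a _ b _ _ => Subsingleton.elim a b, fun c hc => ⟨0, Set.mem_univ _, ?_⟩⟩⟩
  · by_cases h : k' = i
    · subst h
      simp
    · have he : IsEmpty {j : Fin 1 // i = k'} := ⟨fun j => h j.2.symm⟩
      rw [if_neg h, Nat.card_of_isEmpty]
  · show ConjClasses.mk (t : Gqs L v) = c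
    have h := ConjClasses.mk_eq_mk_iff_isConj.mpr (hT t ht (Quotient.out c) hc)
    rwa [← ConjClasses.quotient_mk_eq_mk (Quotient.out c), Quotient.out_eq] at h

/-! ## §3 Type (0): the member `M` (and type (3), by the same hypothesis) -/

variable {L v} in
/-- **Type (0): on `M^{reg}` stable class = class** (`v` non-split), read on a member `T = M` of the Cartan system: ★ p863493 `isStablyConjGAt_iff_isConj_of_mem_cmTorus`.
(Type (3), the cubic Cartans, supply the same statement via K2E3-p27's `isStablyConjGAt_iff_isConj_of_isField_cartanAlgebra`.) [cite: Rogawski1990, §3.6 pp. 28–31] -/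
theorem isConj_of_isStablyConjGAt_of_eq_cmTorus (hns : ∀ w : PlacesOver L v, IsCMField.complexConj L • w.1 = w.1) {T : Subgroup (Gqs L v)}
    (h : T = (cmBorelTriple L 3 v).M) (t : ↥T) (ht : IsRegularElt (((t : Gqs L v)).val : GL (Fin 3) (LocalRing L v)))
    (γ' : Gqs L v) (hst : IsStablyConjGAt L (R90.S4.splitFormGL L) v (t : Gqs L v) γ') : IsConj (t : Gqs L v) γ' := by
  subst h
  exact (isStablyConjGAt_iff_isConj_of_mem_cmTorus hns ht γ').mp hst

open scoped Classical in
/-- **The cheap package at the member `M`** (type (0), `v` non-split): §2 fed with §3. [cite: Rogawski1990, §3.6 pp. 28–31; §12.5 p. 182] -/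
theorem exists_memberPackage_of_eq_cmTorus (hns : ∀ w : PlacesOver L v, IsCMField.complexConj L • w.1 = w.1) {C : Finset (Subgroup (Gqs L v))} (i : ↥C)
    (h : (i : Subgroup (Gqs L v)) = (cmBorelTriple L 3 v).M) :
    ∃ (k : ℕ) (τ : Fin k → ↥C) (e : ∀ j : Fin k, ↥(i : Subgroup (Gqs L v)) ≃ₜ* ↥((τ j : ↥C) : Subgroup (Gqs L v))),
      k = 1 ∧ (∀ k' : ↥C, Nat.card {j : Fin k // τ j = k'} = if k' = i then 1 else 0) ∧
      (∀ (j : Fin k) (t : ↥(i : Subgroup (Gqs L v))),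
          IsStablyConjGAt L (R90.S4.splitFormGL L) v (t : Gqs L v) ((e j t : ↥((τ j : ↥C) : Subgroup (Gqs L v))) : Gqs L v)) ∧
      (∀ (j : Fin k) (t : ↥(i : Subgroup (Gqs L v))), IsRegularElt (((t : Gqs L v)).val : GL (Fin 3) (LocalRing L v)) →
          cartanWeight L v ((τ j : ↥C) : Subgroup (Gqs L v)) (e j t) = cartanWeight L v (i : Subgroup (Gqs L v)) t) ∧
      (∀ t : ↥(i : Subgroup (Gqs L v)), IsRegularElt (((t : Gqs L v)).val : GL (Fin 3) (LocalRing L v)) →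
          Set.BijOn (fun j : Fin k => ConjClasses.mk ((e j t : ↥((τ j : ↥C) : Subgroup (Gqs L v))) : Gqs L v)) Set.univ
            {c : ConjClasses (Gqs L v) | IsStablyConjGAt L (R90.S4.splitFormGL L) v (t : Gqs L v) (Quotient.out c)}) :=
  exists_memberPackage_of_stable_eq_class L v i (isConj_of_isStablyConjGAt_of_eq_cmTorus hns h)

/-! ## §4 A Cartan system all of whose members are cheap carries the dictionary with `n = 1` -/

/-- **If EVERY member of `C` has stable class = class on its regular points, then `IsStableTransportDict L v C (fun _ => 1)`** — §1 fed with the cheap packages of §2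
(`μ = 1`, `N i k′ = [k′ = i]`; (N) is `1 = 1`; the Weyl count (C) collapses to `Σ_i [k′ = i] · [N(T_i):T_i]⁻¹ = [N(T_{k′}):T_{k′}]⁻¹`).  Shows the dictionary inhabited at the cheap
types; for `U(Φ₃)(L⁺_v)` itself types (1) and (2) are NOT cheap (`𝔇 = 4, 2`) and need their own packages. [cite: Rogawski1990, §3.6 pp. 28–31; §12.5 p. 182] -/
theorem isStableTransportDict_one_of_forall_stable_eq_class {C : Finset (Subgroup (Gqs L v))}
    (hall : ∀ (i : ↥C) (t : ↥(i : Subgroup (Gqs L v))), IsRegularElt (((t : Gqs L v)).val : GL (Fin 3) (LocalRing L v)) →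
      ∀ γ' : Gqs L v, IsStablyConjGAt L (R90.S4.splitFormGL L) v (t : Gqs L v) γ' → IsConj (t : Gqs L v) γ') :
    IsStableTransportDict L v C (fun _ => 1) := by
  classical
  refine isStableTransportDict_of_forall_member L v (fun _ => 1) (fun i k' => if k' = i then 1 else 0)
    (fun i => exists_memberPackage_of_stable_eq_class L v i (hall i)) (fun _ _ _ => rfl) fun k' => ?_
  simp only [Nat.cast_ite, Nat.cast_one, Nat.cast_zero, ite_mul, zero_mul, one_mul, inv_one, mul_one, Finset.sum_ite_eq, Finset.mem_univ,
    if_true]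

end TrivialTypes

end Summit.HodgeConjecture.HodgeConjecture.R90.S4

end
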